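import Mathlib
import Literature.Combinatorics.Enumerative.TripleRestrictions
import HarnessLib

/-!
# Simion–Schmidt (1985) §4, Proposition 16*: the classes (c), (d), (e) of triple restrictions are counted by `n`

Continuation of `TripleRestrictions` on the tree's notion `Literature.Combinatorics.Enumerative.PermContainsPattern`;
`A_n(τ₁, τ₂, τ₃) = Nat.card {v : Perm (Fin n) // ¬ C v τ₁ ∧ ¬ C v τ₂ ∧ ¬ C v τ₃}`.

PROPOSITION 16* describes the permutations of the classes (b)–(e) of Lemma 6 explicitly and puts each class in bijection
with `[n]`: «`σ ∈ S_n(132, 213, 231) ⟺ σ = (n, n−1, …, k+1, 1, 2, …, k)`», «`σ ∈ S_n(123, 132, 312) ⟺ σ = (n−1, …, k+1,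
n, k, k−1, …, 1)`», «`σ ∈ S_n(123, 231, 312) ⟺ σ = (k−1, …, 1, n, n−1, …, k)`»; here the class (e) is counted through its
Lemma 6 (e) partner `(132, 213, 321)`, whose members are `(k+1, …, n−1, n, 1, 2, …, k)`.
Each count is `A_n = n` for `n ≥ 1` (`A_0 = 1`), first on words — split at the largest letter with the tools of
`DoubleRestrictionsPowersOfTwo` — then on `Perm (Fin n)`, then moved along Lemma 6 (c), (d), (e).

## References
* [SimionSchmidt1985] R. Simion, F. W. Schmidt, Restricted permutations, European J. Combin. 6 (1985) 383–406, §4: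
  Lemma 6, Proposition 16* (held text `paper:doi-10-1016-s0195-6698-85-80052-4`, p0013–p0015).
-/

namespace Literature.Combinatorics.Enumerative

namespace PermContainsPattern

open Finset Equiv

section Words

variable {α : Type*} [LinearOrder α]

/-- An increasing word has no `231`-sublist. [cite: SimionSchmidt1985, Proposition 16* (proof, held text p0015)] -/
theorem not_has231_of_pairwise_lt {l : List α} (h : l.Pairwise (· < ·)) :
    ¬ ∃ a b c : α, [a, b, c].Sublist l ∧ c < a ∧ a < b := by
  rintro ⟨a, b, c, hs, hca, -⟩
  exact absurd (List.pairwise_iff_forall_sublist.mp h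
    ((List.cons_sublist_cons.mpr (List.sublist_cons_self b [c])).trans hs)) (not_lt.mpr hca.le)

/-- A decreasing word has no `312`-sublist. [cite: SimionSchmidt1985, Proposition 16* (proof, held text p0015)] -/
theorem not_has312_of_pairwise_gt {l : List α} (h : l.Pairwise (fun a b => b < a)) :
    ¬ ∃ a b c : α, [a, b, c].Sublist l ∧ b < c ∧ c < a := by
  rintro ⟨a, b, c, hs, hbc, -⟩
  exact absurd (List.pairwise_iff_forall_sublist.mp h (((List.cons_sublist_cons.mpr
    (List.cons_sublist_cons.mpr (List.nil_sublist ([] : List α)))).cons a).trans hs)) (not_lt.mpr hbc.le)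

/-- A decreasing word has no `123`-sublist. [cite: SimionSchmidt1985, Proposition 16* (proof, held text p0015)] -/
theorem not_has123_of_pairwise_gt {l : List α} (h : l.Pairwise (fun a b => b < a)) :
    ¬ ∃ a b c : α, [a, b, c].Sublist l ∧ a < b ∧ b < c := fun ⟨a, b, c, hs, hab, _⟩ =>
  not_has12_of_pairwise_gt h ⟨a, b, (List.cons_sublist_cons.mpr (List.cons_sublist_cons.mpr
    (List.nil_sublist [c]))).trans hs, hab⟩

omit [LinearOrder α] in
/-- Lists: `l₁ ++ m :: l₂ = l₁' ++ m :: l₂'` with `m ∉ l₁, l₁'` forces `l₁ = l₁'` and `l₂ = l₂'`. [folklore] -/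
private theorem append_cons_inj_of_notMem₃ {m : α} :
    ∀ {l₁ l₁' l₂ l₂' : List α}, m ∉ l₁ → m ∉ l₁' → l₁ ++ m :: l₂ = l₁' ++ m :: l₂' → l₁ = l₁' ∧ l₂ = l₂'
  | [], [], _, _, _, _, h => by simpa using h
  | [], x :: l₁', _, _, _, h', h => by
    simp only [List.nil_append, List.cons_append, List.cons.injEq] at h
    exact absurd (h.1 ▸ List.mem_cons_self) h'
  | x :: l₁, [], _, _, h', _, h => by
    simp only [List.nil_append, List.cons_append, List.cons.injEq] at h
    exact absurd (h.1 ▸ List.mem_cons_self) h'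
  | x :: l₁, x' :: l₁', l₂, l₂', h₁, h₁', h => by
    simp only [List.cons_append, List.cons.injEq] at h
    obtain ⟨rfl, h⟩ := h
    have ih := append_cons_inj_of_notMem₃ (List.not_mem_of_not_mem_cons h₁) (List.not_mem_of_not_mem_cons h₁') h
    exact ⟨by rw [ih.1], ih.2⟩

/-! ### Class (c): `(132, 213, 231)` -/

/-- ★★ **Class (c) on words** «`σ ∈ S_n(132, 213, 231) ⟺ σ = (n, n−1, …, k+1, 1, 2, …, k)`»: the arrangements of `S`
with no `132`-, `213`-, `231`-sublist number `max(#S, 1)` — the largest letter is first (then any avoider on the rest) or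
last (then the rest increases: one word). [cite: SimionSchmidt1985, Proposition 16* (held text p0015)] -/
theorem card_arrangements_not132_not213_not231
    [DecidablePred fun l : List α => (¬ ∃ a b c : α, [a, b, c].Sublist l ∧ a < c ∧ c < b) ∧
      (¬ ∃ a b c : α, [a, b, c].Sublist l ∧ b < a ∧ a < c) ∧ ¬ ∃ a b c : α, [a, b, c].Sublist l ∧ c < a ∧ a < b]
    (S : Finset α) :
    ((Multiset.lists S.val).toFinset.filter (fun l => (¬ ∃ a b c : α, [a, b, c].Sublist l ∧ a < c ∧ c < b) ∧
      (¬ ∃ a b c : α, [a, b, c].Sublist l ∧ b < a ∧ a < c) ∧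
        ¬ ∃ a b c : α, [a, b, c].Sublist l ∧ c < a ∧ a < b)).card = max S.card 1 := by
  set av : Finset α → Finset (List α) := fun T => (Multiset.lists T.val).toFinset.filter
    (fun l => (¬ ∃ a b c : α, [a, b, c].Sublist l ∧ a < c ∧ c < b) ∧
      (¬ ∃ a b c : α, [a, b, c].Sublist l ∧ b < a ∧ a < c) ∧
        ¬ ∃ a b c : α, [a, b, c].Sublist l ∧ c < a ∧ a < b) with hav
  have hmem_av : ∀ (T : Finset α) (l : List α), l ∈ av T ↔ (l.Nodup ∧ ∀ x, x ∈ l ↔ x ∈ T) ∧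
      (¬ ∃ a b c : α, [a, b, c].Sublist l ∧ a < c ∧ c < b) ∧ (¬ ∃ a b c : α, [a, b, c].Sublist l ∧ b < a ∧ a < c) ∧
        ¬ ∃ a b c : α, [a, b, c].Sublist l ∧ c < a ∧ a < b :=
    fun T l => by simp only [hav, Finset.mem_filter, mem_lists_toFinset_iff]
  have hav_empty : av ∅ = {[]} := by
    simp only [hav, lists_toFinset_empty]
    rw [Finset.filter_singleton, if_pos ⟨by rintro ⟨a, b, c, h, -⟩; simp at h, by rintro ⟨a, b, c, h, -⟩; simp at h,
      by rintro ⟨a, b, c, h, -⟩; simp at h⟩]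
  change (av S).card = max S.card 1
  obtain ⟨n, hn⟩ : ∃ n, S.card = n := ⟨_, rfl⟩
  induction n generalizing S with
  | zero => rw [hn, Finset.card_eq_zero.mp hn, hav_empty, Finset.card_singleton]; rfl
  | succ n ih =>
    rw [hn]
    have hS : S.Nonempty := Finset.card_pos.mp (by omega)
    set m := S.max' hS with hm
    set S' := S.erase m with hS'def
    have hmS : m ∈ S := Finset.max'_mem S hS
    have hS' : S'.card = n := by rw [hS'def, Finset.card_erase_of_mem hmS, hn]; rfl
    have hltm : ∀ x ∈ S', x < m := fun x hx => Finset.lt_max'_of_mem_erase_max' S hS hx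
    have hmS' : m ∉ S' := fun h => lt_irrefl m (hltm m h)
    have hmemS : ∀ x, x ∈ S ↔ x = m ∨ x ∈ S' := fun x => by
      rw [hS'def, Finset.mem_erase]
      constructor
      · intro hx
        by_cases h : x = m
        · exact Or.inl h
        · exact Or.inr ⟨h, hx⟩
      · rintro (rfl | ⟨-, hx⟩)
        · exact hmS
        · exact hx
    -- `m` first
    have hcons : ∀ l' ∈ av S', m :: l' ∈ av S := fun l' hl' => by
      rw [hmem_av] at hl' ⊢
      obtain ⟨⟨hnd, hmem⟩, h132, h213, h231⟩ := hl'
      have hlt : ∀ y ∈ l', y < m := fun y hy => hltm y ((hmem y).mp hy)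
      have e132 := has132_append_max_iff [] l' m (by simp) hlt
      have e213 := has213_append_max_iff [] l' m (by simp) hlt
      have e231 := has231_append_max_iff [] l' m (by simp) hlt
      rw [List.nil_append] at e132 e213 e231
      refine ⟨⟨List.nodup_cons.mpr ⟨fun h => hmS' ((hmem m).mp h), hnd⟩, fun x => ?_⟩, ?_, ?_, ?_⟩
      · rw [List.mem_cons, hmemS, hmem]
      · rw [e132]
        rintro (⟨a, b, c, h, -⟩ | h | ⟨x, hx, -⟩)
        · simp at h
        · exact h132 h
        · simp at hx
      · rw [e213]
        rintro (h | ⟨a, b, h, -⟩ | ⟨x, hx, -⟩)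
        · exact h213 h
        · simp at h
        · simp at hx
      · rw [e231]
        rintro (⟨a, b, c, h, -⟩ | h | ⟨x, hx, -⟩)
        · simp at h
        · exact h231 h
        · simp at hx
    -- `m` last: the word `(1, 2, …, n−1, n)`
    set d : List α := (S'.sort : List α) ++ [m] with hd
    have hd_mem : d ∈ av S := by
      rw [hmem_av]
      have hp := (Finset.sortedLT_sort S').pairwise
      have hmemr : ∀ x, x ∈ (S'.sort : List α) ↔ x ∈ S' := fun x => Finset.mem_sort _
      have hlt : ∀ x ∈ (S'.sort : List α), x < m := fun x hx => hltm x ((hmemr x).mp hx)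
      have e132 := has132_append_max_iff _ [] m hlt (by simp)
      have e213 := has213_append_max_iff _ [] m hlt (by simp)
      have e231 := has231_append_max_iff _ [] m hlt (by simp)
      refine ⟨⟨?_, fun x => ?_⟩, ?_, ?_, ?_⟩
      · rw [hd, List.nodup_append]
        refine ⟨Finset.sort_nodup _ _, List.nodup_singleton m, fun x hx y hy => ?_⟩
        rw [List.mem_singleton] at hy
        rw [hy]
        exact (hlt x hx).ne
      · rw [hd, List.mem_append, List.mem_singleton, hmemr, hmemS, or_comm]
      · rw [hd, e132]
        rintro (h | ⟨a, b, c, h, -⟩ | ⟨x, -, y, hy, -⟩)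
        · exact not_has132_of_pairwise_lt hp h
        · simp at h
        · simp at hy
      · rw [hd, e213]
        rintro (⟨a, b, c, h, -⟩ | h | ⟨x, -, b, c, h, -⟩)
        · simp at h
        · exact not_has21_of_pairwise_lt hp h
        · simp at h
      · rw [hd, e231]
        rintro (h | ⟨a, b, c, h, -⟩ | ⟨x, -, y, hy, -⟩)
        · exact not_has231_of_pairwise_lt hp h
        · simp at h
        · simp at hy
    -- every avoider is `m :: l'` or `d`
    have hsplit : ∀ l ∈ av S, (∃ l' ∈ av S', m :: l' = l) ∨ l = d := fun l hl => by
      rw [hmem_av] at hl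
      obtain ⟨⟨hnd, hmem⟩, h132, h213, h231⟩ := hl
      obtain ⟨l₁, l₂, rfl, hn₁, hn₂, -, hmem₂, hmem₁, hm₁, hm₂, hbelow⟩ :=
        exists_split_at_max S' hltm hnd (fun x => by rw [hmem x, hmemS]) h132
      have hS'₂ : ∀ y ∈ l₂, y ∈ S' := fun y hy => Finset.filter_subset _ _ ((hmem₂ y).mp hy)
      have hS'₁ : ∀ x ∈ l₁, x ∈ S' := fun x hx => Finset.sdiff_subset ((hmem₁ x).mp hx)
      by_cases h₁ : l₁ = []
      · subst h₁
        left
        have hsub : l₂.Sublist ([] ++ m :: l₂) := List.sublist_cons_self m l₂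
        refine ⟨l₂, ?_, rfl⟩
        rw [hmem_av]
        refine ⟨⟨hn₂, fun y => ⟨hS'₂ y, fun hy => ?_⟩⟩, fun ⟨a, b, c, hs, hh⟩ => h132 ⟨a, b, c, hs.trans hsub, hh⟩,
          fun ⟨a, b, c, hs, hh⟩ => h213 ⟨a, b, c, hs.trans hsub, hh⟩,
          fun ⟨a, b, c, hs, hh⟩ => h231 ⟨a, b, c, hs.trans hsub, hh⟩⟩
        have := (hmem y).mpr ((hmemS y).mpr (Or.inr hy))
        rw [List.nil_append, List.mem_cons] at this
        rcases this with rfl | h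
        · exact absurd hy hmS'
        · exact h
      by_cases h₂ : l₂ = []
      · subst h₂
        right
        -- `l₁` increases (no `213` ending in `m`) and uses all of `S'`
        have hlt : l₁.Pairwise (· < ·) := pairwise_lt_of_not_has21 hn₁ fun ⟨a, b, hs, hba⟩ =>
          h213 ((has213_append_max_iff l₁ [] m hm₁ hm₂).mpr (Or.inr (Or.inl ⟨a, b, hs, hba⟩)))
        have hmem₁' : ∀ x, x ∈ l₁ ↔ x ∈ S' := fun x => ⟨hS'₁ x, fun hx => by
          have := (hmem x).mpr ((hmemS x).mpr (Or.inr hx))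
          rw [List.mem_append, List.mem_singleton] at this
          rcases this with h | rfl
          · exact h
          · exact absurd hx hmS'⟩
        rw [hd, eq_sort_of_pairwise_lt hlt hmem₁']
      exfalso
      obtain ⟨x, hx⟩ := List.exists_mem_of_ne_nil l₁ h₁
      obtain ⟨y, hy⟩ := List.exists_mem_of_ne_nil l₂ h₂
      exact h231 ((has231_append_max_iff l₁ l₂ m hm₁ hm₂).mpr (Or.inr (Or.inr ⟨x, hx, y, hy, hbelow x hx y hy⟩)))
    have hU : av S = (av S').image (fun l => m :: l) ∪ {d} := by
      ext l
      simp only [Finset.mem_union, Finset.mem_image, Finset.mem_singleton]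
      constructor
      · exact hsplit l
      · rintro (⟨l', hl', rfl⟩ | rfl)
        · exact hcons l' hl'
        · exact hd_mem
    rw [hU]
    rcases n with _ | n
    · have hS'e : S' = ∅ := Finset.card_eq_zero.mp hS'
      have hde : d = [m] := by rw [hd, hS'e]; simp
      rw [hS'e, hav_empty, hde]
      simp
    · rw [Finset.card_union_of_disjoint, Finset.card_image_of_injective _ List.cons_injective, ih S' hS',
        Finset.card_singleton, hS']
      · omega
      · rw [Finset.disjoint_singleton_right, Finset.mem_image]
        rintro ⟨l', -, he⟩
        have hne : (S'.sort : List α) ≠ [] := by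
          rw [ne_eq, ← List.length_eq_zero_iff, Finset.length_sort, hS']
          exact Nat.succ_ne_zero n
        obtain ⟨z, t, hz⟩ := List.exists_cons_of_ne_nil hne
        rw [hd, hz, List.cons_append, List.cons.injEq] at he
        have hzS' : z ∈ S' := by
          rw [← Finset.mem_sort (· ≤ ·), hz]
          exact List.mem_cons_self
        exact hmS' (he.1 ▸ hzS')

/-! ### Class (d): `(123, 132, 312)` -/

/-- ★★ **Class (d) on words** «`σ ∈ S_n(123, 132, 312) ⟺ σ = (n−1, …, k+1, n, k, k−1, …, 1)`»: the arrangements of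
`S` with no `123`-, `132`-, `312`-sublist number `max(#S, 1)` — in `l₁ m l₂` the letters of `l₂` are the `|l₂|` smallest
(no `132`) and decrease (no `312` starting with `m`), those of `l₁` decrease (no `123` ending with `m`): one word for each
position of `m`. [cite: SimionSchmidt1985, Proposition 16* (held text p0015)] -/
theorem card_arrangements_not123_not132_not312
    [DecidablePred fun l : List α => (¬ ∃ a b c : α, [a, b, c].Sublist l ∧ a < b ∧ b < c) ∧
      (¬ ∃ a b c : α, [a, b, c].Sublist l ∧ a < c ∧ c < b) ∧ ¬ ∃ a b c : α, [a, b, c].Sublist l ∧ b < c ∧ c < a]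
    (S : Finset α) :
    ((Multiset.lists S.val).toFinset.filter (fun l => (¬ ∃ a b c : α, [a, b, c].Sublist l ∧ a < b ∧ b < c) ∧
      (¬ ∃ a b c : α, [a, b, c].Sublist l ∧ a < c ∧ c < b) ∧
        ¬ ∃ a b c : α, [a, b, c].Sublist l ∧ b < c ∧ c < a)).card = max S.card 1 := by
  set av : Finset α → Finset (List α) := fun T => (Multiset.lists T.val).toFinset.filter
    (fun l => (¬ ∃ a b c : α, [a, b, c].Sublist l ∧ a < b ∧ b < c) ∧
      (¬ ∃ a b c : α, [a, b, c].Sublist l ∧ a < c ∧ c < b) ∧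
        ¬ ∃ a b c : α, [a, b, c].Sublist l ∧ b < c ∧ c < a) with hav
  have hmem_av : ∀ (T : Finset α) (l : List α), l ∈ av T ↔ (l.Nodup ∧ ∀ x, x ∈ l ↔ x ∈ T) ∧
      (¬ ∃ a b c : α, [a, b, c].Sublist l ∧ a < b ∧ b < c) ∧ (¬ ∃ a b c : α, [a, b, c].Sublist l ∧ a < c ∧ c < b) ∧
        ¬ ∃ a b c : α, [a, b, c].Sublist l ∧ b < c ∧ c < a :=
    fun T l => by simp only [hav, Finset.mem_filter, mem_lists_toFinset_iff]
  rcases Nat.eq_zero_or_pos S.card with hn | hn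
  · rw [hn, Finset.card_eq_zero.mp hn]
    change (av ∅).card = max 0 1
    have hav_empty : av ∅ = {[]} := by
      simp only [hav, lists_toFinset_empty]
      rw [Finset.filter_singleton, if_pos ⟨by rintro ⟨a, b, c, h, -⟩; simp at h, by rintro ⟨a, b, c, h, -⟩; simp at h,
        by rintro ⟨a, b, c, h, -⟩; simp at h⟩]
    rw [hav_empty, Finset.card_singleton]
    rfl
  obtain ⟨n, hn⟩ : ∃ n, S.card = n + 1 := ⟨S.card - 1, by omega⟩
  change (av S).card = max S.card 1
  rw [hn]
  have hS : S.Nonempty := Finset.card_pos.mp (by omega)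
  set m := S.max' hS with hm
  set S' := S.erase m with hS'def
  have hmS : m ∈ S := Finset.max'_mem S hS
  have hS' : S'.card = n := by rw [hS'def, Finset.card_erase_of_mem hmS, hn]; rfl
  have hltm : ∀ x ∈ S', x < m := fun x hx => Finset.lt_max'_of_mem_erase_max' S hS hx
  have hmS' : m ∉ S' := fun h => lt_irrefl m (hltm m h)
  have hmemS : ∀ x, x ∈ S ↔ x = m ∨ x ∈ S' := fun x => by
    rw [hS'def, Finset.mem_erase]
    constructor
    · intro hx
      by_cases h : x = m
      · exact Or.inl h
      · exact Or.inr ⟨h, hx⟩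
    · rintro (rfl | ⟨-, hx⟩)
      · exact hmS
      · exact hx
  -- `low j` = the `j` smallest letters of `S'`; `dec j` = the others decreasing, `dsc j` = `low j` decreasing
  set low : ℕ → Finset α := fun j => S'.filter (fun x => (S'.filter (· < x)).card < j) with hlow
  have hlow_card : ∀ j ≤ n, (low j).card = j := fun j hj => card_filter_rank_lt S' (by rw [hS']; exact hj)
  set dec : ℕ → List α := fun j => ((S' \ low j).sort : List α).reverse with hdec
  set dsc : ℕ → List α := fun j => ((low j).sort : List α).reverse with hdsc
  have hdec_mem : ∀ j x, x ∈ dec j ↔ x ∈ S' \ low j := fun j x => by rw [hdec, List.mem_reverse, Finset.mem_sort]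
  have hdsc_mem : ∀ j x, x ∈ dsc j ↔ x ∈ low j := fun j x => by rw [hdsc, List.mem_reverse, Finset.mem_sort]
  have hdec_nodup : ∀ j, (dec j).Nodup := fun j => List.nodup_reverse.mpr (Finset.sort_nodup _ _)
  have hdsc_nodup : ∀ j, (dsc j).Nodup := fun j => List.nodup_reverse.mpr (Finset.sort_nodup _ _)
  have hdec_gt : ∀ j, (dec j).Pairwise (fun a b => b < a) := fun j => pairwise_gt_reverse_sort _
  have hdsc_gt : ∀ j, (dsc j).Pairwise (fun a b => b < a) := fun j => pairwise_gt_reverse_sort _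
  have hmdec : ∀ j, m ∉ dec j := fun j h => hmS' (Finset.sdiff_subset ((hdec_mem j m).mp h))
  have hdsc_len : ∀ j ≤ n, (dsc j).length = j := fun j hj => by
    rw [hdsc, List.length_reverse, Finset.length_sort, hlow_card j hj]
  -- the word `w j = dec j ++ m :: dsc j` is an avoider
  set w : ℕ → List α := fun j => dec j ++ m :: dsc j with hw
  have hw_mem : ∀ j, w j ∈ av S := fun j => by
    rw [hmem_av]
    obtain ⟨hnd, hmem, hm₁, hm₂, hbelow⟩ :=
      glue_at_max S' hltm j (hdec_nodup j) (hdsc_nodup j) (hdsc_mem j) (hdec_mem j)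
    refine ⟨⟨hnd, fun x => by rw [hmem x, hmemS]⟩, ?_, ?_, ?_⟩
    · rw [has123_append_max_iff _ _ m hm₁ hm₂]
      rintro (h | h | ⟨x, -, b, c, hs, -, hbc⟩)
      · exact not_has123_of_pairwise_gt (hdsc_gt j) h
      · exact not_has12_of_pairwise_gt (hdec_gt j) h
      · exact not_has12_of_pairwise_gt (hdsc_gt j) ⟨b, c, hs, hbc⟩
    · rw [has132_append_max_iff _ _ m hm₁ hm₂]
      rintro (h | h | ⟨x, hx, y, hy, hxy⟩)
      · exact not_has132_of_pairwise_gt (hdec_gt j) h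
      · exact not_has132_of_pairwise_gt (hdsc_gt j) h
      · exact absurd hxy (not_lt.mpr (hbelow x hx y hy).le)
    · rw [has312_append_max_iff _ _ m hm₁ hm₂]
      rintro (h | h | ⟨y, hy, a, b, hs, hby, -⟩)
      · exact not_has312_of_pairwise_gt (hdec_gt j) h
      · exact not_has12_of_pairwise_gt (hdsc_gt j) h
      · exact absurd hby (not_lt.mpr (hbelow b (hs.subset (by simp)) y hy).le)
  -- every avoider is some `w j`, `j ≤ n`
  have hsplit : ∀ l ∈ av S, ∃ j ∈ Finset.range (n + 1), w j = l := fun l hl => by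
    rw [hmem_av] at hl
    obtain ⟨⟨hnd, hmem⟩, h123, h132, h312⟩ := hl
    obtain ⟨l₁, l₂, rfl, hn₁, hn₂, hlen, hmem₂, hmem₁, hm₁, hm₂, hbelow⟩ :=
      exists_split_at_max S' hltm hnd (fun x => by rw [hmem x, hmemS]) h132
    rw [hS'] at hlen
    refine ⟨l₂.length, Finset.mem_range.mpr (by omega), ?_⟩
    have hgt₁ : l₁.Pairwise (fun a b => b < a) := pairwise_gt_of_not_has12 hn₁ fun ⟨a, b, hs, hab⟩ =>
      h123 ((has123_append_max_iff l₁ l₂ m hm₁ hm₂).mpr (Or.inr (Or.inl ⟨a, b, hs, hab⟩)))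
    have hgt₂ : l₂.Pairwise (fun a b => b < a) := pairwise_gt_of_not_has12 hn₂ fun ⟨a, b, hs, hab⟩ =>
      h312 ((has312_append_max_iff l₁ l₂ m hm₁ hm₂).mpr (Or.inr (Or.inl ⟨a, b, hs, hab⟩)))
    rw [hw]
    simp only []
    rw [show dec l₂.length = l₁ from (eq_reverse_sort_of_pairwise_gt hgt₁ hmem₁).symm,
      show dsc l₂.length = l₂ from (eq_reverse_sort_of_pairwise_gt hgt₂ hmem₂).symm]
  have hU : av S = (Finset.range (n + 1)).image w := by
    ext l
    rw [Finset.mem_image]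
    constructor
    · exact hsplit l
    · rintro ⟨j, -, rfl⟩
      exact hw_mem j
  rw [hU, Finset.card_image_of_injOn, Finset.card_range]
  · omega
  · intro j hj j' hj' he
    rw [Finset.mem_coe, Finset.mem_range] at hj hj'
    have e := congrArg List.length (append_cons_inj_of_notMem₃ (hmdec j) (hmdec j') he).2
    rwa [hdsc_len j (by omega), hdsc_len j' (by omega)] at e

/-! ### Class (e) through its Lemma 6 (e) partner `(132, 213, 321)` -/

/-- ★★ **`(132, 213, 321)` on words**: the arrangements of `S` with no `132`-, `213`-, `321`-sublist number
`max(#S, 1)` — in `l₁ m l₂` the letters of `l₂` are the smallest ones and increase (no `321` starting with `m`), those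
of `l₁` increase (no `213` ending with `m`): one word `(k+1, …, n−1, n, 1, …, k)` for each position of `m`; by reversal
this is the printed «`σ ∈ S_n(123, 231, 312) ⟺ σ = (k−1, …, 1, n, n−1, …, k)`».
[cite: SimionSchmidt1985, Proposition 16* (held text p0015)] -/
theorem card_arrangements_not132_not213_not321
    [DecidablePred fun l : List α => (¬ ∃ a b c : α, [a, b, c].Sublist l ∧ a < c ∧ c < b) ∧
      (¬ ∃ a b c : α, [a, b, c].Sublist l ∧ b < a ∧ a < c) ∧ ¬ ∃ a b c : α, [a, b, c].Sublist l ∧ c < b ∧ b < a]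
    (S : Finset α) :
    ((Multiset.lists S.val).toFinset.filter (fun l => (¬ ∃ a b c : α, [a, b, c].Sublist l ∧ a < c ∧ c < b) ∧
      (¬ ∃ a b c : α, [a, b, c].Sublist l ∧ b < a ∧ a < c) ∧
        ¬ ∃ a b c : α, [a, b, c].Sublist l ∧ c < b ∧ b < a)).card = max S.card 1 := by
  set av : Finset α → Finset (List α) := fun T => (Multiset.lists T.val).toFinset.filter
    (fun l => (¬ ∃ a b c : α, [a, b, c].Sublist l ∧ a < c ∧ c < b) ∧
      (¬ ∃ a b c : α, [a, b, c].Sublist l ∧ b < a ∧ a < c) ∧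
        ¬ ∃ a b c : α, [a, b, c].Sublist l ∧ c < b ∧ b < a) with hav
  have hmem_av : ∀ (T : Finset α) (l : List α), l ∈ av T ↔ (l.Nodup ∧ ∀ x, x ∈ l ↔ x ∈ T) ∧
      (¬ ∃ a b c : α, [a, b, c].Sublist l ∧ a < c ∧ c < b) ∧ (¬ ∃ a b c : α, [a, b, c].Sublist l ∧ b < a ∧ a < c) ∧
        ¬ ∃ a b c : α, [a, b, c].Sublist l ∧ c < b ∧ b < a :=
    fun T l => by simp only [hav, Finset.mem_filter, mem_lists_toFinset_iff]
  rcases Nat.eq_zero_or_pos S.card with hn | hn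
  · rw [hn, Finset.card_eq_zero.mp hn]
    change (av ∅).card = max 0 1
    have hav_empty : av ∅ = {[]} := by
      simp only [hav, lists_toFinset_empty]
      rw [Finset.filter_singleton, if_pos ⟨by rintro ⟨a, b, c, h, -⟩; simp at h, by rintro ⟨a, b, c, h, -⟩; simp at h,
        by rintro ⟨a, b, c, h, -⟩; simp at h⟩]
    rw [hav_empty, Finset.card_singleton]
    rfl
  obtain ⟨n, hn⟩ : ∃ n, S.card = n + 1 := ⟨S.card - 1, by omega⟩
  change (av S).card = max S.card 1
  rw [hn]
  have hS : S.Nonempty := Finset.card_pos.mp (by omega)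
  set m := S.max' hS with hm
  set S' := S.erase m with hS'def
  have hmS : m ∈ S := Finset.max'_mem S hS
  have hS' : S'.card = n := by rw [hS'def, Finset.card_erase_of_mem hmS, hn]; rfl
  have hltm : ∀ x ∈ S', x < m := fun x hx => Finset.lt_max'_of_mem_erase_max' S hS hx
  have hmS' : m ∉ S' := fun h => lt_irrefl m (hltm m h)
  have hmemS : ∀ x, x ∈ S ↔ x = m ∨ x ∈ S' := fun x => by
    rw [hS'def, Finset.mem_erase]
    constructor
    · intro hx
      by_cases h : x = m
      · exact Or.inl h
      · exact Or.inr ⟨h, hx⟩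
    · rintro (rfl | ⟨-, hx⟩)
      · exact hmS
      · exact hx
  set low : ℕ → Finset α := fun j => S'.filter (fun x => (S'.filter (· < x)).card < j) with hlow
  have hlow_card : ∀ j ≤ n, (low j).card = j := fun j hj => card_filter_rank_lt S' (by rw [hS']; exact hj)
  set inc : ℕ → List α := fun j => ((S' \ low j).sort : List α) with hinc
  set asc : ℕ → List α := fun j => ((low j).sort : List α) with hasc
  have hinc_mem : ∀ j x, x ∈ inc j ↔ x ∈ S' \ low j := fun j x => by rw [hinc, Finset.mem_sort]
  have hasc_mem : ∀ j x, x ∈ asc j ↔ x ∈ low j := fun j x => by rw [hasc, Finset.mem_sort]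
  have hinc_lt : ∀ j, (inc j).Pairwise (· < ·) := fun j => (Finset.sortedLT_sort _).pairwise
  have hasc_lt : ∀ j, (asc j).Pairwise (· < ·) := fun j => (Finset.sortedLT_sort _).pairwise
  have hminc : ∀ j, m ∉ inc j := fun j h => hmS' (Finset.sdiff_subset ((hinc_mem j m).mp h))
  have hasc_len : ∀ j ≤ n, (asc j).length = j := fun j hj => by rw [hasc, Finset.length_sort, hlow_card j hj]
  set w : ℕ → List α := fun j => inc j ++ m :: asc j with hw
  have hw_mem : ∀ j, w j ∈ av S := fun j => by
    rw [hmem_av]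
    obtain ⟨hnd, hmem, hm₁, hm₂, hbelow⟩ :=
      glue_at_max S' hltm j (Finset.sort_nodup _ _) (Finset.sort_nodup _ _) (hasc_mem j) (hinc_mem j)
    refine ⟨⟨hnd, fun x => by rw [hmem x, hmemS]⟩, ?_, ?_, ?_⟩
    · rw [has132_append_max_iff _ _ m hm₁ hm₂]
      rintro (h | h | ⟨x, hx, y, hy, hxy⟩)
      · exact not_has132_of_pairwise_lt (hinc_lt j) h
      · exact not_has132_of_pairwise_lt (hasc_lt j) h
      · exact absurd hxy (not_lt.mpr (hbelow x hx y hy).le)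
    · rw [has213_append_max_iff _ _ m hm₁ hm₂]
      rintro (h | h | ⟨x, hx, b, c, hs, -, hxc⟩)
      · exact not_has213_of_pairwise_lt (hasc_lt j) h
      · exact not_has21_of_pairwise_lt (hinc_lt j) h
      · exact absurd hxc (not_lt.mpr (hbelow x hx c (hs.subset (by simp))).le)
    · rw [has321_append_max_iff _ _ m hm₁ hm₂]
      rintro (h | h | ⟨a, b, hs, hba, -⟩)
      · exact not_has321_of_pairwise_lt (hinc_lt j) h
      · exact not_has21_of_pairwise_lt (hasc_lt j) h
      · exact not_has21_of_pairwise_lt (hinc_lt j) ⟨a, b, hs, hba⟩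
  have hsplit : ∀ l ∈ av S, ∃ j ∈ Finset.range (n + 1), w j = l := fun l hl => by
    rw [hmem_av] at hl
    obtain ⟨⟨hnd, hmem⟩, h132, h213, h321⟩ := hl
    obtain ⟨l₁, l₂, rfl, hn₁, hn₂, hlen, hmem₂, hmem₁, hm₁, hm₂, hbelow⟩ :=
      exists_split_at_max S' hltm hnd (fun x => by rw [hmem x, hmemS]) h132
    rw [hS'] at hlen
    refine ⟨l₂.length, Finset.mem_range.mpr (by omega), ?_⟩
    have hlt₁ : l₁.Pairwise (· < ·) := pairwise_lt_of_not_has21 hn₁ fun ⟨a, b, hs, hba⟩ =>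
      h213 ((has213_append_max_iff l₁ l₂ m hm₁ hm₂).mpr (Or.inr (Or.inl ⟨a, b, hs, hba⟩)))
    have hlt₂ : l₂.Pairwise (· < ·) := pairwise_lt_of_not_has21 hn₂ fun ⟨b, c, hs, hcb⟩ =>
      h321 ((has321_append_max_iff l₁ l₂ m hm₁ hm₂).mpr (Or.inr (Or.inl ⟨b, c, hs, hcb⟩)))
    rw [hw]
    simp only []
    rw [show inc l₂.length = l₁ from (eq_sort_of_pairwise_lt hlt₁ hmem₁).symm,
      show asc l₂.length = l₂ from (eq_sort_of_pairwise_lt hlt₂ hmem₂).symm]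
  have hU : av S = (Finset.range (n + 1)).image w := by
    ext l
    rw [Finset.mem_image]
    constructor
    · exact hsplit l
    · rintro ⟨j, -, rfl⟩
      exact hw_mem j
  rw [hU, Finset.card_image_of_injOn, Finset.card_range]
  · omega
  · intro j hj j' hj' he
    rw [Finset.mem_coe, Finset.mem_range] at hj hj'
    have e := congrArg List.length (append_cons_inj_of_notMem₃ (hminc j) (hminc j') he).2
    rwa [hasc_len j (by omega), hasc_len j' (by omega)] at e

end Words

/-! ### The counts on permutations; PROPOSITION 16* -/

section Perms

/-- ★★★ **PROPOSITION 16*, class (c)**: `A_n(132, 213, 231) = n` (`n ≥ 1`) — «`σ ∈ S_n(132,213,231) ⟺ σ =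
(n, n−1, …, k+1, 1, 2, …, k)` for some `1 ≤ k ≤ n`». [cite: SimionSchmidt1985, Proposition 16* (held text p0015)] -/
theorem card_av132_av213_av231 (n : ℕ) (hn : 1 ≤ n) :
    Nat.card {v : Perm (Fin n) // ¬ PermContainsPattern v ![1, 3, 2] ∧ ¬ PermContainsPattern v ![2, 1, 3] ∧
      ¬ PermContainsPattern v ![2, 3, 1]} = n := by
  classical
  refine (natCard_perm_eq_card_filter_arrangements n
    (fun v : Perm (Fin n) => ¬ PermContainsPattern v ![1, 3, 2] ∧ ¬ PermContainsPattern v ![2, 1, 3] ∧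
      ¬ PermContainsPattern v ![2, 3, 1])
    (fun l : List ℕ => (¬ ∃ a b c : ℕ, [a, b, c].Sublist l ∧ a < c ∧ c < b) ∧
      (¬ ∃ a b c : ℕ, [a, b, c].Sublist l ∧ b < a ∧ a < c) ∧ ¬ ∃ a b c : ℕ, [a, b, c].Sublist l ∧ c < a ∧ a < b)
    (fun v => by rw [has132_ofFn_perm_iff, has213_ofFn_perm_iff, has231_ofFn_perm_iff])).trans ?_
  rw [card_arrangements_not132_not213_not231 (α := ℕ) (Finset.range n), Finset.card_range]
  exact max_eq_left hn

/-- Class (c): `A_n(132, 213, 312) = n`. [cite: SimionSchmidt1985, Proposition 16* and Lemma 6 (c) (held text p0014–p0015)] -/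
theorem card_av132_av213_av312 (n : ℕ) (hn : 1 ≤ n) :
    Nat.card {v : Perm (Fin n) // ¬ PermContainsPattern v ![1, 3, 2] ∧ ¬ PermContainsPattern v ![2, 1, 3] ∧
      ¬ PermContainsPattern v ![3, 1, 2]} = n := by
  rw [← card_av132_av213_av231_eq_card_av132_av213_av312, card_av132_av213_av231 n hn]

/-- Class (c): `A_n(132, 231, 312) = n`. [cite: SimionSchmidt1985, Proposition 16* and Lemma 6 (c) (held text p0014–p0015)] -/
theorem card_av132_av231_av312 (n : ℕ) (hn : 1 ≤ n) :
    Nat.card {v : Perm (Fin n) // ¬ PermContainsPattern v ![1, 3, 2] ∧ ¬ PermContainsPattern v ![2, 3, 1] ∧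
      ¬ PermContainsPattern v ![3, 1, 2]} = n := by
  rw [← card_av132_av213_av231_eq_card_av132_av231_av312, card_av132_av213_av231 n hn]

/-- Class (c): `A_n(213, 231, 312) = n`. [cite: SimionSchmidt1985, Proposition 16* and Lemma 6 (c) (held text p0014–p0015)] -/
theorem card_av213_av231_av312 (n : ℕ) (hn : 1 ≤ n) :
    Nat.card {v : Perm (Fin n) // ¬ PermContainsPattern v ![2, 1, 3] ∧ ¬ PermContainsPattern v ![2, 3, 1] ∧
      ¬ PermContainsPattern v ![3, 1, 2]} = n := by
  rw [← card_av132_av213_av231_eq_card_av213_av231_av312, card_av132_av213_av231 n hn]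

/-- ★★★ **PROPOSITION 16*, class (d)**: `A_n(123, 132, 312) = n` (`n ≥ 1`) — «`σ ∈ S_n(123,132,312) ⟺ σ =
(n−1, n−2, …, k+1, n, k, k−1, …, 2, 1)`». [cite: SimionSchmidt1985, Proposition 16* (held text p0015)] -/
theorem card_av123_av132_av312 (n : ℕ) (hn : 1 ≤ n) :
    Nat.card {v : Perm (Fin n) // ¬ PermContainsPattern v ![1, 2, 3] ∧ ¬ PermContainsPattern v ![1, 3, 2] ∧
      ¬ PermContainsPattern v ![3, 1, 2]} = n := by
  classical
  refine (natCard_perm_eq_card_filter_arrangements n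
    (fun v : Perm (Fin n) => ¬ PermContainsPattern v ![1, 2, 3] ∧ ¬ PermContainsPattern v ![1, 3, 2] ∧
      ¬ PermContainsPattern v ![3, 1, 2])
    (fun l : List ℕ => (¬ ∃ a b c : ℕ, [a, b, c].Sublist l ∧ a < b ∧ b < c) ∧
      (¬ ∃ a b c : ℕ, [a, b, c].Sublist l ∧ a < c ∧ c < b) ∧ ¬ ∃ a b c : ℕ, [a, b, c].Sublist l ∧ b < c ∧ c < a)
    (fun v => by rw [has123_ofFn_perm_iff, has132_ofFn_perm_iff, has312_ofFn_perm_iff])).trans ?_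
  rw [card_arrangements_not123_not132_not312 (α := ℕ) (Finset.range n), Finset.card_range]
  exact max_eq_left hn

/-- Class (d): `A_n(123, 213, 231) = n`. [cite: SimionSchmidt1985, Proposition 16* and Lemma 6 (d) (held text p0014–p0015)] -/
theorem card_av123_av213_av231 (n : ℕ) (hn : 1 ≤ n) :
    Nat.card {v : Perm (Fin n) // ¬ PermContainsPattern v ![1, 2, 3] ∧ ¬ PermContainsPattern v ![2, 1, 3] ∧
      ¬ PermContainsPattern v ![2, 3, 1]} = n := by
  rw [← card_av123_av132_av312_eq_card_av123_av213_av231, card_av123_av132_av312 n hn]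

/-- Class (d): `A_n(132, 312, 321) = n`. [cite: SimionSchmidt1985, Proposition 16* and Lemma 6 (d) (held text p0014–p0015)] -/
theorem card_av132_av312_av321 (n : ℕ) (hn : 1 ≤ n) :
    Nat.card {v : Perm (Fin n) // ¬ PermContainsPattern v ![1, 3, 2] ∧ ¬ PermContainsPattern v ![3, 1, 2] ∧
      ¬ PermContainsPattern v ![3, 2, 1]} = n := by
  rw [← card_av123_av132_av312_eq_card_av132_av312_av321, card_av123_av132_av312 n hn]

/-- Class (d): `A_n(213, 231, 321) = n`. [cite: SimionSchmidt1985, Proposition 16* and Lemma 6 (d) (held text p0014–p0015)] -/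
theorem card_av213_av231_av321 (n : ℕ) (hn : 1 ≤ n) :
    Nat.card {v : Perm (Fin n) // ¬ PermContainsPattern v ![2, 1, 3] ∧ ¬ PermContainsPattern v ![2, 3, 1] ∧
      ¬ PermContainsPattern v ![3, 2, 1]} = n := by
  rw [← card_av123_av132_av312_eq_card_av213_av231_av321, card_av123_av132_av312 n hn]

/-- ★★★ **PROPOSITION 16*, class (e)**, through its Lemma 6 (e) partner: `A_n(132, 213, 321) = n` (`n ≥ 1`).
[cite: SimionSchmidt1985, Proposition 16* and Lemma 6 (e) (held text p0014–p0015)] -/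
theorem card_av132_av213_av321 (n : ℕ) (hn : 1 ≤ n) :
    Nat.card {v : Perm (Fin n) // ¬ PermContainsPattern v ![1, 3, 2] ∧ ¬ PermContainsPattern v ![2, 1, 3] ∧
      ¬ PermContainsPattern v ![3, 2, 1]} = n := by
  classical
  refine (natCard_perm_eq_card_filter_arrangements n
    (fun v : Perm (Fin n) => ¬ PermContainsPattern v ![1, 3, 2] ∧ ¬ PermContainsPattern v ![2, 1, 3] ∧
      ¬ PermContainsPattern v ![3, 2, 1])
    (fun l : List ℕ => (¬ ∃ a b c : ℕ, [a, b, c].Sublist l ∧ a < c ∧ c < b) ∧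
      (¬ ∃ a b c : ℕ, [a, b, c].Sublist l ∧ b < a ∧ a < c) ∧ ¬ ∃ a b c : ℕ, [a, b, c].Sublist l ∧ c < b ∧ b < a)
    (fun v => by rw [has132_ofFn_perm_iff, has213_ofFn_perm_iff, has321_ofFn_perm_iff])).trans ?_
  rw [card_arrangements_not132_not213_not321 (α := ℕ) (Finset.range n), Finset.card_range]
  exact max_eq_left hn

/-- PROPOSITION 16*, class (e) as printed: `A_n(123, 231, 312) = n` (`n ≥ 1`) — «`σ ∈ S_n(123,231,312) ⟺ σ =
(k−1, …, 3, 2, 1, n, n−1, …, k)`». [cite: SimionSchmidt1985, Proposition 16* and Lemma 6 (e) (held text p0014–p0015)] -/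
theorem card_av123_av231_av312 (n : ℕ) (hn : 1 ≤ n) :
    Nat.card {v : Perm (Fin n) // ¬ PermContainsPattern v ![1, 2, 3] ∧ ¬ PermContainsPattern v ![2, 3, 1] ∧
      ¬ PermContainsPattern v ![3, 1, 2]} = n := by
  rw [card_av123_av231_av312_eq_card_av132_av213_av321, card_av132_av213_av321 n hn]

/-- The summary of §4 «`A_n(R)`, `|R| = 3`, will take on one of the following values: `0, 1, n, or F_{n+1}`» — the values
`n` (classes (b)–(e)) and `F_{n+1}` (class (a)) side by side, `n ≥ 1`.
[cite: SimionSchmidt1985, §4, introduction (held text p0013)] -/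
theorem card_av_triple_values (n : ℕ) (hn : 1 ≤ n) :
    Nat.card {v : Perm (Fin n) // ¬ PermContainsPattern v ![1, 2, 3] ∧ ¬ PermContainsPattern v ![1, 3, 2] ∧
      ¬ PermContainsPattern v ![2, 1, 3]} = Nat.fib (n + 1) ∧
    Nat.card {v : Perm (Fin n) // ¬ PermContainsPattern v ![1, 2, 3] ∧ ¬ PermContainsPattern v ![1, 3, 2] ∧
      ¬ PermContainsPattern v ![2, 3, 1]} = n ∧
    Nat.card {v : Perm (Fin n) // ¬ PermContainsPattern v ![1, 3, 2] ∧ ¬ PermContainsPattern v ![2, 1, 3] ∧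
      ¬ PermContainsPattern v ![2, 3, 1]} = n ∧
    Nat.card {v : Perm (Fin n) // ¬ PermContainsPattern v ![1, 2, 3] ∧ ¬ PermContainsPattern v ![1, 3, 2] ∧
      ¬ PermContainsPattern v ![3, 1, 2]} = n ∧
    Nat.card {v : Perm (Fin n) // ¬ PermContainsPattern v ![1, 2, 3] ∧ ¬ PermContainsPattern v ![2, 3, 1] ∧
      ¬ PermContainsPattern v ![3, 1, 2]} = n :=
  ⟨card_av123_av132_av213 n, card_av123_av132_av231 n hn, card_av132_av213_av231 n hn, card_av123_av132_av312 n hn,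
    card_av123_av231_av312 n hn⟩

end Perms

end PermContainsPattern

end Literature.Combinatorics.Enumerative
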